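import Literature.NumberTheory.EllipticCurves.Rank1Residual.Typed.Basic

/-!
# Sketch — crux idea «kato-bottom-layer-exczero» on `ErratumRoadFive.EulerHalfNotRamNoInertSetAtFive`
(planner-bsd-idea-9-g31; elaboration check of the idea card's First lemma; nothing here is a route item)

The composition of the line at one pair `(W, p)` in tree currency. Data (all read off ONE curve):
* `q`  — the rational analytic order of `Ш` (`shaAn W = q`, analytic rank one);
* `t`  — the index of Kato's bottom class `z_ℚ = κ₁` in the compact relaxed-at-`p` Selmer group
         `Sel_rel(ℚ, T_pE) = ℤ_p · x` (Mazur–Rubin `∂⁰(κ)`);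
* `e`  — the local free index of the Mordell–Weil generator `x` in `(E(ℚ_p) ⊗ ℤ_p)/tors`;
* `m`  — `ord_p #E(ℚ_p)[p^∞]`;  `c` — `ord_p c_p(E) = ord_p (ord_p q_E)` (split multiplicative `p`);
* `v`  — `ord_p ( log_E(res_p z_ℚ) / log_E(x)² )`.
Hypotheses: `hKim` = Kim 2022 Thm 2.12 (MR Thm 5.2.2 for `(T_pE, F_can)`) together with
`length Sel_0(ℚ,E[p^∞]) = ord_p #Ш + e` (all bad `ℓ ≠ p` additive ⇒ `H¹(ℚ_ℓ,T) = 0`);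
`hidx` = the Tate-curve computation `ord_p log_E(x̂) = 1 - c + m`;
`hC` = the TRANSFER statement C⁺ (integral exceptional-zero Perrin-Riou formula, valuation form);
`hm` = the sub-class `E(ℚ_p)[p] = 0`. Conclusion: the Euler half `Typed.MissingUpperBoundAt W p`.
-/

namespace Summit.BirchSwinnertonDyer.BirchSwinnertonDyer.Cruxes.EulerHalfNotRamNoInertSetAtFive.KatoBottomLayerExcZero

open Literature.NumberTheory.EllipticCurves Literature.NumberTheory.EllipticCurves.Rank1Residual.Typed

/-- First lemma of the line (bookkeeping composition; the number theory sits in the four hypotheses). -/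
theorem missingUpperBoundAt_of_bottomLayer (W : WeierstrassCurve ℚ) (p : ℕ) [Fact p.Prime]
    (q : ℚ) (hq : shaAn W = (q : ℂ))
    (t e m c : ℕ) (v : ℤ)
    (hKim : (padicValNat p W.shaOrder : ℤ) + e ≤ t)
    (hidx : (t : ℤ) = v + e + 1 - c + m)
    (hC : v = padicValRat p q + c - 1)
    (hm : m = 0) :
    MissingUpperBoundAt W p :=
  ⟨q, hq, by omega⟩

/-- The same composition WITHOUT the sub-class restriction: the defect is exactly `m = ord_p #E(ℚ_p)[p^∞]`
(input J3 of the card asks whether a refined Kolyvagin-system argument removes it). -/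
theorem sha_le_shaAn_add_torsionDefect (W : WeierstrassCurve ℚ) (p : ℕ) [Fact p.Prime]
    (q : ℚ) (t e m c : ℕ) (v : ℤ)
    (hKim : (padicValNat p W.shaOrder : ℤ) + e ≤ t)
    (hidx : (t : ℤ) = v + e + 1 - c + m)
    (hC : v = padicValRat p q + c - 1) :
    (padicValNat p W.shaOrder : ℤ) ≤ padicValRat p q + m := by
  omega

end Summit.BirchSwinnertonDyer.BirchSwinnertonDyer.Cruxes.EulerHalfNotRamNoInertSetAtFive.KatoBottomLayerExcZero
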